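import Mathlib
import HarnessLib
import Summits.Ventures.LatticeQCDFlow.Exactness.SphereSweepTHMCExact
import Summits.Ventures.LatticeQCDFlow.Exactness.SphereLatticeHMCTangential

/-!
# THMC with the Engel–Schaefer LO sweep, run with sitewise TANGENT Gaussian momenta, is exact

HONEST FRAMING: exact (Metropolis-corrected) sampling algorithms for lattice gauge theory;
figures of merit are autocorrelation/cost numbers at stated couplings and volumes; no
continuum-physics claim.

Venture `LatticeQCDFlow` (cell pub-lqcd), topic `Exactness`; FANOUT row 7 (`s0-cpn-null`: the
S0-D1 rung — 2D CP⁹ THMC).  NEW WORK of the cell: the last bookkeeping step between the tree's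
end-to-end THMC theorem `SphereSweepTHMCExact.lattice_sphere_thmc_sweep_gaussian_exact` (momenta
refreshed from the product Gaussian of the AMBIENT `(ℝ^d)^Λ`, normal components carried and inert)
and the chain the CP(N−1) code runs (momenta drawn TANGENT to each site sphere): by
`SphereLatticeHMCTangential.latticeHMC_config_eq_tangentRefresh` the two V-variable configuration
kernels are EQUAL for a sitewise-tangent force, hence so are the THMC kernels reported through the
sweep.  Nothing is cited as a fact.  Printed counterpart, NAMED ONLY: Engel–Schaefer, Comput.
Phys. Commun. 182 (2011) 2107, §§2–3.

## Content

* **`lattice_sphere_thmc_sweep_tangentGaussian_exact`** — THMC = (tangent Gaussian momentum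
  refresh at the V-configuration, `N` exact-geodesic lattice-leapfrog steps with a sitewise-tangent
  site-coupling force, flip, Metropolis for `H̃ = (S ∘ F − log sweepJac) + Σ_s ‖p_s‖²/2`, momenta
  forgotten) reported through GEN-5's LO sweep `F = kickSweepEquiv`: `e^{−S}·uniformSphere^Λ` is
  invariant.

NOT CLAIMED: that the code's force is `−∇H̃` projected (exactness holds for any sitewise-tangent
measurable force); the U(1) link factors; ergodicity; numbers.
-/

noncomputable section

namespace Summit.Ventures.LatticeQCDFlow.Exactness

open MeasureTheory Measure Metric Set Real ProbabilityTheory InnerProductGeometry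
open Summit.Ventures.LatticeQCDFlow.Theory2
open scoped ENNReal InnerProductSpace

section TangentTHMC

variable {m : Type*} [Fintype m] [DecidableEq m] [Nonempty m] {Λ : Type*} [Fintype Λ]
  (n : ℕ) (hV : Module.finrank ℝ (EuclideanSpace ℝ m) = n + 2) (c : ℝ)
  {p q : Λ → Prop} [DecidablePred p] [DecidablePred q]
  (L₁ : SiteLocalField (EuclideanSpace ℝ m) c p) (L₂ : SiteLocalField (EuclideanSpace ℝ m) c q)

/-- **THMC WITH THE E–S LO SWEEP AND TANGENT GAUSSIAN MOMENTA IS EXACT** — the chain the CP(N−1)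
code runs: at the V-configuration draw sitewise tangent Gaussian momenta
(`latticeTangentMomentumLaw` of the product Gaussian), integrate `H̃ = (S ∘ F − log sweepJac) +
Σ_s ‖p_s‖²/2` by `N` exact-geodesic lattice-leapfrog steps with a sitewise-tangent site-coupling
force, flip, accept/reject, forget the momenta, report `U = F V` through the sweep:
`e^{−S}·uniformSphere^Λ` is invariant. -/
theorem lattice_sphere_thmc_sweep_tangentGaussian_exact
    {S : (Λ → (sphere (0 : EuclideanSpace ℝ m) 1)) → ℝ} (hS : Measurable S)
    {Fc : (Λ → (sphere (0 : EuclideanSpace ℝ m) 1)) → (Λ → EuclideanSpace ℝ m)} (hFc : Measurable Fc)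
    (hFt : ∀ (x : Λ → (sphere (0 : EuclideanSpace ℝ m) 1)) (s : Λ),
      ⟪((x s : (sphere (0 : EuclideanSpace ℝ m) 1)) : EuclideanSpace ℝ m), Fc x s⟫_ℝ = 0)
    (δ : ℝ) (N : ℕ) :
    ProbabilityTheory.Kernel.Invariant
      (conjKernel
        (refreshUpdateK
          (involMH ⇑((latticeFlipPerm : Equiv.Perm ((Λ → (sphere (0 : EuclideanSpace ℝ m) 1)) ×
              (Λ → EuclideanSpace ℝ m))) * latticeLeapfrogPerm Fc δ ^ N)
            (measurePreserving_latticeProposal (two_le_card_of_finrank n hV) hFc δ N).measurable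
            fun z : (Λ → (sphere (0 : EuclideanSpace ℝ m) 1)) × (Λ → EuclideanSpace ℝ m) =>
              (S (kickSweepEquiv n hV c L₁ L₂ z.1) -
                Real.log (sweepJac p q (fun a y g => sphereKick c (L₁.J a y) g) (classJac n c L₁)
                  (classJac n c L₂) z.1)) + ∑ s, ‖z.2 s‖ ^ 2 / 2)
          (latticeTangentMomentumLaw
            ((((Measure.pi fun _ : Λ => (volume : Measure (EuclideanSpace ℝ m))).withDensity
                (fun π' => ENNReal.ofReal (Real.exp (-(∑ s, ‖π' s‖ ^ 2 / 2)))) Set.univ)⁻¹ •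
              (Measure.pi fun _ : Λ => (volume : Measure (EuclideanSpace ℝ m))).withDensity
                fun π' => ENNReal.ofReal (Real.exp (-(∑ s, ‖π' s‖ ^ 2 / 2)))))))
        (kickSweepEquiv n hV c L₁ L₂))
      ((Measure.pi fun _ : Λ => uniformSphere (volume : Measure (EuclideanSpace ℝ m))).withDensity
        fun x => ENNReal.ofReal (Real.exp (-S x))) := by
  have hSt : Measurable fun U : Λ → (sphere (0 : EuclideanSpace ℝ m) 1) =>
      S (kickSweepEquiv n hV c L₁ L₂ U) -
        Real.log (sweepJac p q (fun a y g => sphereKick c (L₁.J a y) g) (classJac n c L₁)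
          (classJac n c L₂) U) :=
    (hS.comp (kickSweepEquiv n hV c L₁ L₂).measurable).sub
      (Real.measurable_log.comp (measurable_esSweepJac n c L₁ L₂ hV))
  rw [← latticeHMC_config_eq_tangentRefresh (two_le_card_of_finrank n hV) hSt hFc hFt δ N]
  exact lattice_sphere_thmc_sweep_gaussian_exact n hV c L₁ L₂ hS hFc δ N

end TangentTHMC

end Summit.Ventures.LatticeQCDFlow.Exactness

end
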